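/-
Copyright (c) 2026 the pub-hodgecm-mathlib formalisation cell (harness21).  Prover seat hodgecm-mathlib-LH4-p08 (g2), req620 Track A «(D-RAM) FOUR-FRAME» squad, unit U3_Laws (iii),
MS ROAD STAGE B (Stage B lead LH4-p10 (g2), MS ledger LH4-p11; dealer LH4-plan (g11)): B56-ASSEMBLY — THE SOCKET `stub_B56_G1` of `B10-StableCountTypeZero.SKELETON.v1` (c61f53438acbd4dd :84)
VERBATIM, FILE F4.  2026-09-04.
-/
import Summits.HodgeConjecture.HodgeConjecture.Theorems.F0P3cDyRamDiagonalGluedTubeContribution   -- F2 (this seat): tube summand, empty regimes off the foot; brings ★ B5 (iv) p856104 and its imports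
import Summits.HodgeConjecture.HodgeConjecture.Theorems.F0P3cDyRamDiagonalGluedFootContribution   -- F3b (this seat): glue summand ∕ zero on the foot; brings F3a
import Summits.HodgeConjecture.HodgeConjecture.Theorems.F0P3cDyRamDiagonalGluedStratum            -- ★ p856131 F1 (F0P3-p01 (g31)): `stratum_G1_eq`, `stratum_G1_eq_empty_of_odd`
import Summits.HodgeConjecture.HodgeConjecture.Theorems.F0P3cDyRamGlueUnitRationalityDepth        -- ★ p856146 bridge (this seat): `exists_fixed_v_add_glueUnit_le_iff`
import Literature.NumberTheory.LocalFields.WildQuadraticDatumTraceBound                         -- ★ (LH4-p07 (g3)): `trace_bound_of_isRamifiedQuadraticDatum`; brings ★ `UnitaryThreeFourFrameDefs`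
import Literature.NumberTheory.Automorphic.UnitaryThreeFourFrameFixedCosetDictionary             -- ★ `v_eq_one_of_mul_map_eq_one`
import HarnessLib

/-!
# Crux `H413`, MS ROAD STAGE B, B56-ASSEMBLY FILE F4: THE SOCKET `stub_B56_G1` — the glued strata with foot on `B₁`, axis `(2ρ, 2ρ+s, 2ρ+s)`:
# `∑ᶠ_{M ∈ stratum (2ρ,2ρ+s,2ρ+s)} 1∕[𝒰 : S_F(M)] = [tube] (q−1)q^{2ρ+s∕2−1} + [glue] q^{2ρ+s∕2−⌈(2ρ−n₂)∕2⌉}`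

Cell `hodgecm-mathlib` (D-0151), FLOOR 0, crux item H413 = `stmt-HodgeConjecture-24833`; lane `--supports stmt-HodgeConjecture-24833 --as helper` (count-neutral).  THEOREMS ONLY (no `def`,
no instance, no notation, no `sorry`, default heartbeats).  ONE theorem, the skeleton's `stub_B56_G1` :84 with its binders BYTE-IDENTICAL (`K : Type`, `[Fintype 𝓀[K]]`, `hD h2 hE hN₀ hT ρ s hρ hs`),
so B10 pastes `theorem stub_B56_G1 … := finsum_stabiliserWeight_hasAxis_G1 hD h2 hE hN₀ hT ρ s hρ hs` and §P (LH4-p13 (g2) ★ `…Permutation`) transports it to `stub_P_G2 ∕ stub_P_G3`.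
THE CASE TREE.  `s` odd ⇒ stratum empty (★ F1 `stratum_G1_eq_empty_of_odd`), both summands `0`.  `s = 2t`: ★ F1 `stratum_G1_eq` makes the stratum the glued stable dualisable family;
TUBE `2ρ+2t ≤ n₁ ∧ 2ρ ≤ n₂` (then `ρ ≤ 2ρ ≤ n₃` by ★ isoceles) ⇒ ★ F2 `finsum_stabiliserWeight_glued_tube_eq`, glue summand off (`n₂ < 2ρ` fails); NOT TUBE, OFF THE FOOT `n₁ ≠ n₂ + 2t` ⇒ ★ F2
`glued_eq_empty_of_offFoot`; ON THE FOOT (`n₃ = n₂` by isoceles, `n₂ < 2ρ`): `n₂ < ρ` ⇒ ★ F2 `glued_eq_empty_of_depth_lt` (and `2ρ − n₂ ≤ n₂ − d + 1` fails); `ρ ≤ n₂ < 2ρ` ⇒ ★ F3b, with the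
switch «∃ fixed `f₀`, `|f₀ + (β−1)∕(α−1)| ≤ |ϖ|^{2ρ+2t−n₂}`» ⟺ `2ρ − n₂ ≤ n₂ − d + 1` by the ★ bridge `exists_fixed_v_add_glueUnit_le_iff` (`d`-depth of `α, β` from `d ≤ N₀ ≤ nᵢ`).
* HEAD **`finsum_stabiliserWeight_hasAxis_G1`** = `stub_B56_G1`.
HONEST LABEL.  Count-neutral; nothing printed is asserted; the census laws stay PROVER TARGETS; `HC_CM` is proved only modulo the 7 printed citations (2 remaining named inputs: hLiu418 =
`stmt-HodgeConjecture-24832`, h413 = `stmt-HodgeConjecture-24833`) until rung 0 closes.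

## References
* [Kottwitz1986BaseChangeUnits] R. Kottwitz, *Base change for unit elements of Hecke algebras*, Compositio Math. 60 (1986), §1 pp. 240–241 (fixed-lattice counts via torus orbits and stabilisers).
* [Rogawski1990] J. D. Rogawski, *Automorphic Representations of Unitary Groups in Three Variables*, Ann. of Math. Stud. 123 (1990), §4.9 Prop. 4.9.1 (a) p. 55.
-/

set_option autoImplicit false

noncomputable section

namespace Summit.HodgeConjecture.HodgeConjecture.Cruxes.H413.F0P3cDyRamDiagonalGluedSocket

open Matrix
open Literature.NumberTheory.Automorphic Literature.NumberTheory.Automorphic.HermitianLattice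
open Literature.NumberTheory.Automorphic.UnitaryLatticeTree Literature.NumberTheory.Automorphic.UnitaryThreeFourFrame
open Literature.NumberTheory.LocalFields.WildQuadraticDatum
open Summit.HodgeConjecture.HodgeConjecture.Cruxes.H413.F0P3cDyRamDiagonalTorusDefs
open Summit.HodgeConjecture.HodgeConjecture.Cruxes.H413.F0P3cDyRamDiagonalStrataDefs
open Summit.HodgeConjecture.HodgeConjecture.Cruxes.H413.F0P3cDyRamDiagonalGluedStabiliserIndex (ne_zero_and_v_lt_one_of_v_eq_exp)
open Summit.HodgeConjecture.HodgeConjecture.Cruxes.H413.F0P3cDyRamDiagonalGluedStratum (stratum_G1_eq stratum_G1_eq_empty_of_odd)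
open Summit.HodgeConjecture.HodgeConjecture.Cruxes.H413.F0P3cDyRamDiagonalGluedTubeContribution
open Summit.HodgeConjecture.HodgeConjecture.Cruxes.H413.F0P3cDyRamDiagonalGluedFootContribution
open Summit.HodgeConjecture.HodgeConjecture.Cruxes.H413.F0P3cDyRamGlueUnitRationalityDepth (exists_fixed_v_add_glueUnit_le_iff)
open scoped Valued WithZero Matrix MatrixGroups

section Socket

variable {K : Type} [Field K] [Valued K ℤᵐ⁰] [Fintype 𝓀[K]] {σ : K →+* K} {ϖ : K} {d t : ℕ} {α β : K} {N₀ n₁ n₂ n₃ : ℕ} {T : GL (Fin 3) K}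

/-- **SOCKET `stub_B56_G1` — GLUED STRATA WITH FOOT ON `B₁`**, axis `(2ρ, 2ρ+s, 2ρ+s)`, `ρ, s ≥ 1`: TUBE contribution `(q−1)q^{2ρ+s∕2−1}` iff `s` even, `2ρ ≤ min(n₂,n₃)`, `2ρ + s ≤ n₁`;
GLUE contribution `q^{2ρ+s∕2−⌈(2ρ−m)∕2⌉}` iff `s` even, `n₂ = n₃ =: m`, `n₁ = m + s`, `m < 2ρ`, `2ρ − m ≤ m − d + 1` (dyadic fence `|2| < 1`, `d ≤ N₀`).  Binders of the skeleton
`B10-StableCountTypeZero.SKELETON.v1` :84 verbatim. [cite: Kottwitz1986BaseChangeUnits, §1 pp. 240–241] [cite: Rogawski1990, §4.9 Prop. 4.9.1 (a) p. 55] -/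
theorem finsum_stabiliserWeight_hasAxis_G1 (hD : IsRamifiedQuadraticDatum σ ϖ d t) (h2 : Valued.v (2 : K) < 1) (hE : IsElementDatum σ ϖ N₀ α β n₁ n₂ n₃) (hN₀ : d ≤ N₀)
    (hT : (T : Matrix (Fin 3) (Fin 3) K) = Matrix.diagonal ![α, β, 1]) (ρ s : ℕ) (hρ : 1 ≤ ρ) (hs : 1 ≤ s) :
    ∑ᶠ M ∈ stratum σ ϖ T ![2 * ρ, 2 * ρ + s, 2 * ρ + s], stabiliserWeight σ M =
      (if 2 ∣ s ∧ 2 * ρ ≤ min n₂ n₃ ∧ 2 * ρ + s ≤ n₁ then (((Fintype.card 𝓀[K] : ℚ) - 1) * (Fintype.card 𝓀[K] : ℚ) ^ (2 * ρ + s / 2 - 1)) else 0) +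
      (if 2 ∣ s ∧ n₂ = n₃ ∧ n₁ = n₂ + s ∧ n₂ < 2 * ρ ∧ 2 * ρ - n₂ ≤ n₂ - d + 1
        then ((Fintype.card 𝓀[K] : ℚ) ^ (2 * ρ + s / 2 - (2 * ρ - n₂ + 1) / 2)) else 0) := by
  have hTr := trace_bound_of_isRamifiedQuadraticDatum hD h2
  obtain ⟨hσ, hvσ, hϖ, hfix, hd, h1d, -⟩ := hD
  obtain ⟨hαn, hβn, -, hα1, hβ1, h₁, h₂, h₃, hN1, hN2, hN3⟩ := hE
  have hα := v_eq_one_of_mul_map_eq_one hvσ hαn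
  have hβ := v_eq_one_of_mul_map_eq_one hvσ hβn
  have h₃' : Valued.v (β - α) = Valued.v ϖ ^ n₃ := by rw [Valuation.map_sub_swap, h₃]
  obtain ⟨hϖ0, hϖ1⟩ := ne_zero_and_v_lt_one_of_v_eq_exp hϖ
  obtain ⟨hi1, hi2, -⟩ := isoceles_depths hϖ h₁ h₂ h₃
  rw [← Nat.card_eq_fintype_card]
  by_cases hpar : 2 ∣ s
  · obtain ⟨t', rfl⟩ := hpar
    have ht' : 1 ≤ t' := by omega
    rw [show 2 * t' / 2 = t' by omega, stratum_G1_eq hvσ hfix hϖ T hρ hs]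
    by_cases htube : 2 * ρ + 2 * t' ≤ n₁ ∧ 2 * ρ ≤ n₂
    · -- THE TUBE
      have hn₃ : 2 * ρ ≤ n₃ := le_trans (le_min (by omega) htube.2) hi1
      rw [finsum_stabiliserWeight_glued_tube_eq hσ hvσ hfix hϖ hd hTr hα hβ T hT h₁ h₂ h₃' ρ t' hρ ht' htube.1 htube.2 (by omega),
        if_pos ⟨dvd_mul_right 2 t', le_min htube.2 hn₃, htube.1⟩, if_neg (fun h => absurd h.2.2.2.1 (not_lt.2 htube.2)), add_zero]
    · rw [if_neg (fun h => htube ⟨h.2.2, (le_min_iff.1 h.2.1).1⟩), zero_add]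
      by_cases hfoot : n₁ = n₂ + 2 * t'
      · -- ON THE FOOT: `n₃ = n₂ < 2ρ`
        have hn₃ : n₃ = n₂ := by
          rcases min_le_iff.1 hi1 with h | h <;> rcases min_le_iff.1 hi2 with h' | h' <;> omega
        subst hn₃
        have hm : n₃ < 2 * ρ := by
          by_contra hge
          exact htube ⟨by omega, not_lt.1 hge⟩
        rw [hfoot] at h₁
        by_cases hρm : ρ ≤ n₃
        · -- THE GLUE REGIME `ρ ≤ m < 2ρ`
          have hvϖ0 : Valued.v ϖ ≠ 0 := (Valuation.ne_zero_iff _).2 hϖ0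
          have hg : Valued.v ((β - 1) / (α - 1)) = Valued.v ϖ ^ (2 * t') := by
            rw [map_div₀, h₁, h₂, pow_add, mul_div_cancel_left₀ _ (pow_ne_zero n₃ hvϖ0)]
          have hαd : Valued.v (α - 1) ≤ Valued.v ϖ ^ d := by rw [h₂]; exact (v_pow_le_v_pow_iff hϖ _ _).2 (by omega)
          have hβd : Valued.v (β - 1) ≤ Valued.v ϖ ^ d := by rw [h₁]; exact (v_pow_le_v_pow_iff hϖ _ _).2 (by omega)
          have hswitch := exists_fixed_v_add_glueUnit_le_iff hσ hvσ hfix hϖ hd h1d hαn hβn hα1 hβ1 hαd hβd h₃ (by omega) hg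
            (by omega : 2 * t' ≤ 2 * ρ + 2 * t' - n₃)
          by_cases hrat : ∃ f : K, σ f = f ∧ Valued.v (f + (β - 1) / (α - 1)) ≤ Valued.v ϖ ^ (2 * ρ + 2 * t' - n₃)
          · obtain ⟨f₀, hσf₀, hf₀⟩ := hrat
            have hle : 2 * ρ - n₃ ≤ n₃ - d + 1 := by have := hswitch.1 ⟨f₀, hσf₀, hf₀⟩; omega
            rw [finsum_stabiliserWeight_glued_foot_eq hσ hvσ hfix hϖ hd hTr hα hβ T hT ρ t' n₃ hρ ht' h₁ h₂ h₃' hρm hm hσf₀ hf₀,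
              if_pos ⟨dvd_mul_right 2 t', rfl, hfoot, hm, hle⟩]
          · rw [finsum_stabiliserWeight_glued_foot_eq_zero hσ hvσ hfix hϖ hd hTr hα hβ T hT ρ t' n₃ hρ ht' h₁ h₂ h₃' hρm hm hrat,
              if_neg (fun h => hrat (hswitch.2 (by have := h.2.2.2.2; omega)))]
        · -- TOO SHALLOW: `m < ρ`
          rw [glued_eq_empty_of_depth_lt σ hϖ hα hβ T hT h₃' ρ (2 * t') (not_le.1 hρm), finsum_mem_empty,
            if_neg (fun h => by have := h.2.2.2.2; omega)]
      · -- OFF THE FOOT, BELOW THE TUBE: nothing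
        rw [glued_eq_empty_of_offFoot σ hϖ0 hϖ1 hα hβ T hT h₁ h₂ ρ (2 * t') hfoot htube, finsum_mem_empty, if_neg (fun h => hfoot h.2.2.1)]
  · -- `s` ODD: the stratum is empty
    rw [stratum_G1_eq_empty_of_odd hvσ hfix hϖ T hρ hpar, finsum_mem_empty, if_neg (fun h => hpar h.1), if_neg (fun h => hpar h.1), add_zero]

end Socket

end Summit.HodgeConjecture.HodgeConjecture.Cruxes.H413.F0P3cDyRamDiagonalGluedSocket

end
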